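import Summits.Ventures.CertifiedManyBodySolver.Observables.PairLROOnePointCeilingSteps
import Summits.Ventures.CertifiedManyBodySolver.Observables.StripePointBridge
import Literature.MathematicalPhysics.QuantumLattice.PairFieldCommutatorLocality
import Mathlib.Order.LiminfLimsup
import HarnessLib

/-!
# A certified ONE-POINT ceiling over low-energy states is a ceiling on the summit's pair-field LRO
# sequence: `liminf_k u_k ≤ 2M²` (source-free Koma–Tasaki / Kaplan–Horsch–von der Linden route)

HONEST FRAMING: first certified bounds on pairing observables; not a superconductivity verdict; every
number certified (two lineages + referee) or labelled float. Crew hubbard-obs (D-0042), seat hubbard-obs-p1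
(`prover-hubbard-obs-p1-g5-0`, completing the g4 chain PairLROOnePointWitness{Table,,Lattice} /
PairLROOnePointCeiling{Aux,Steps} / PairFieldCommutatorLocality). Zero compute; no definition; no named fact;
no `sorry`. This file is the SOUNDNESS HALF of the source-free one-point route: it turns a ONE-POINT
VARIATIONAL BOUND — an inequality valid for EVERY unit vector `ζ` of every large torus,

  `c − A + Σ_σ μ_σ (Re⟨ζ, N_σ ζ⟩/L² − ν) + κ (u − Re⟨ζ, H_L ζ⟩/L²) ≤ −Re⟨ζ, Δ_g ζ⟩/L²`      (OP1)

(`H_L = hubbardTorus 2 L t U`, `N_σ` the spin-resolved particle numbers, `Δ_g = pairField g L`; this is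
exactly the shape in which a translation-invariant moment-positivity certificate WITHOUT stationarity rows
and WITHOUT charged-word rows is read in the translation-averaged state of an arbitrary unit vector — the
"energy-window / variational" tier of the RDM bootstrap, Wang et al. 2024 §III; the certificate-to-(OP1)
step is `Literature/…/OrbitStateVariationalCertificate` + its torus/window pull-back) — into the ceiling

  `liminf_k u_k ≤ 2 M²`,  `M := −(c − A + (Σ_σ μ_σ)(n/2 − ν))`,

on the summit's LRO sequence `u_k = |Λ_{2k}|⁻² Σ_{x,y ∈ Λ_{2k}} P_g(2k; x, y)` of ANY family of unit
`(N_L(n), S^z = 0)`-sector ground states (`N_L(n) = rectN n L`), provided `κ ≥ 0` and the energy density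
`e(t, 0, U, n) ≤ u` (a certified cap). NO source field, NO `h → 0` extrapolation, NO grand-canonical
Legendre transform, NO footprint floor: `M` is whatever the one-point object certifies.

## The argument (finite volume only; Koma–Tasaki 1994 §2.2, Kaplan–Horsch–von der Linden 1989)

If `liminf u_k > c₀ > 2M²`, then for every large even `L = 2k` the sector ground state `ψ_L` has
`Re⟨ψ_L, Δ†Δ ψ_L⟩ ≥ c₀ L⁴`, hence `a_L² := ‖(Δ + Δ†)ψ_L‖² = Re⟨Δ†Δ⟩ + Re⟨ΔΔ†⟩ ≥ 2c₀L⁴ − C_γ L²` by the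
locality bound `|Re⟨[Δ, Δ†]⟩| ≤ C_γ L²` (`PairFieldCommutatorLocality`). The KHvdL unit vector
`Ξ_L = (ψ_L + (Δ+Δ†)ψ_L/a_L)/√2` (`exists_onePointWitness_numerics`) has `Re⟨Ξ, Δ Ξ⟩ = a_L/2`, energy
`≤ E_L + C_δ L²/(4a_L²)` (double-commutator locality) and spin fillings within `C_γ L²/(2a_L²)` of `N_L/2`.
Reading (OP1) in `Ξ_L` and collecting the `O(L⁻⁴)` corrections (`onePoint_real_step`) gives
`√(2c₀ − C_γ/L²)/2 ≤ −(c − A + (Σμ)(N_L/(2L²) − ν) + κ(u − E_L/L²)) + K/L⁴`; letting `k → ∞`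
(`N_L/L² → n`, `E_L/L² → e ≤ u`) yields `√(2c₀)/2 ≤ M − κ(u − e) ≤ M`, i.e. `c₀ ≤ 2M²` — contradiction.

## Contents
* `onePoint_finite_step` — one torus: the displayed inequality from (OP1), the LRO floor `c₀L⁴ ≤ Re⟨Δ†Δ⟩`
  and the two locality constants.
* **`liminf_pairFieldLRO_le_of_onePoint_variational_bound`** — the ceiling `liminf u_k ≤ 2M²`.
* `M3ObsPairLROCeilingAt_tp0_of_onePoint_variational_bound` — registry consumer at `(U, n, t') = (8, 7/8, 0)`,
  `g = g_d`: with the cap node `M3EnergyUpperRow 0 hi`, `hi ≤ u`, an (OP1) bound gives the summit-format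
  leaf `M3ObsPairLROCeilingAt_tp0 c'` for every rational `c' ≥ 2M²`; and `stripePointCeiling_of_onePoint_
  variational_bound` — thence route item `StripePointCeiling` (stmt-9492) when `c' ≤ 1/200`.
HONEST: no (OP1) bound is supplied here (that is the certificate's job); a ceiling, never presence.

References: T. Koma, H. Tasaki, J. Stat. Phys. 76 (1994) 745, §2.2 Theorem 2.2 [KomaTasaki1994];
T. A. Kaplan, P. Horsch, W. von der Linden, J. Phys. Soc. Jpn. 58 (1989) 3894 [KaplanHorschVonDerLinden1989];
J. Wang et al., PRX 14 (2024) 031006, §III [WangEtAl2024]; D. J. Scalapino, Phys. Rep. 250 (1995) 329,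
§2 eq. (2.4) [Scalapino1995].
-/

noncomputable section

namespace Summit.Ventures.CertifiedManyBodySolver.Observables

open Matrix Complex Finset Literature.MathematicalPhysics.QuantumLattice Literature.Probability.LatticeModels
open Literature.MathematicalPhysics.QuantumLattice.HubbardWave0 ThermodynamicLimit Filter Topology
open Literature.MathematicalPhysics.QuantumManyBody.StateRelaxation
open scoped ComplexOrder ComplexConjugate BigOperators

/-! ### §1  One torus -/

section Finite

variable {L : ℕ} [NeZero L] (g : Site 2 → ℝ)

/-- **The finite-volume step.** On one torus of side `L`: a unit sector ground state `ψ` (sector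
`(N, S^z = 0)`) of `H = hubbardTorus 2 L t U` with LRO floor `c₀ L⁴ ≤ Re⟨ψ, Δ†Δ ψ⟩` (`c₀ > 0`), locality
constants `|Re⟨ψ, [Δ, Δ†] ψ⟩| ≤ C_γ L²`, `‖⟨ψ, [O, [H, O]] ψ⟩‖ ≤ C_δ L²` (`O = Δ + Δ†`), and a one-point
variational bound (OP1) valid for every unit vector of the torus (`κ ≥ 0` not even needed here), give
`√(2c₀ − C_γ/L²)/2 ≤ −(c − A + (Σ_σ μ_σ)((N/2)/L² − ν) + κ(u − E/L²)) + K/L⁴`,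
`E = minEnergyOn (szSector N 0)`, `K = ((Σ|μ_σ|)C_γ/2 + κC_δ/4)/c₀`.
[cite: KomaTasaki1994, Theorem 2.2 (2.9)] [cite: KaplanHorschVonDerLinden1989] -/
theorem onePoint_finite_step (t U : ℝ) {N : ℕ} {ψ : Fock (Orb (FermionTorus 2 L))}
    (hψ1 : star ψ ⬝ᵥ ψ = 1) (hgs : IsGroundStateInSector (hubbardTorus 2 L t U) N 0 ψ)
    {c A κ u ν c₀ Cγ Cδ : ℝ} (μ : Fin 2 → ℝ) (hκ : 0 ≤ κ) (hc₀ : 0 < c₀) (hCγ : 0 ≤ Cγ) (hCδ : 0 ≤ Cδ)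
    (hγ : |(expect (pairField g L * (pairField g L)ᴴ - (pairField g L)ᴴ * pairField g L) ψ).re| ≤
      Cγ * (L : ℝ) ^ 2)
    (hδ : ‖expect ((pairField g L + (pairField g L)ᴴ) *
              (hubbardTorus 2 L t U * (pairField g L + (pairField g L)ᴴ) -
                (pairField g L + (pairField g L)ᴴ) * hubbardTorus 2 L t U) -
            (hubbardTorus 2 L t U * (pairField g L + (pairField g L)ᴴ) -
                (pairField g L + (pairField g L)ᴴ) * hubbardTorus 2 L t U) *
              (pairField g L + (pairField g L)ᴴ)) ψ‖ ≤ Cδ * (L : ℝ) ^ 2)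
    (hlro : c₀ * (L : ℝ) ^ 4 ≤ (expect ((pairField g L)ᴴ * pairField g L) ψ).re)
    (hbound : ∀ ζ : Fock (Orb (FermionTorus 2 L)), star ζ ⬝ᵥ ζ = 1 →
      c - A + ∑ σ : Fin 2, μ σ *
          ((star ζ ⬝ᵥ ((∑ y : FermionTorus 2 L, numberOp y σ) *ᵥ ζ)).re / (L : ℝ) ^ 2 - ν) +
        κ * (u - (star ζ ⬝ᵥ (hubbardTorus 2 L t U *ᵥ ζ)).re / (L : ℝ) ^ 2) ≤
        -((expect (pairField g L) ζ).re / (L : ℝ) ^ 2)) :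
    Real.sqrt (2 * c₀ - Cγ / (L : ℝ) ^ 2) / 2 ≤
      -(c - A + (∑ σ : Fin 2, μ σ) * (((N : ℝ) / 2) / (L : ℝ) ^ 2 - ν) +
          κ * (u - (hubbardTorus 2 L t U).minEnergyOn (szSector N 0) / (L : ℝ) ^ 2)) +
        (((∑ σ : Fin 2, |μ σ|) * Cγ / 2 + κ * Cδ / 4) / c₀) / (L : ℝ) ^ 4 := by
  have hHh : (hubbardTorus 2 L t U).IsHermitian := by
    have h := hubbardTorusTT'_isHermitian L t 0 U
    rwa [hubbardTorusTT'_zero] at h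
  have hL : (0 : ℝ) < (L : ℝ) := Nat.cast_pos.2 (Nat.pos_of_ne_zero (NeZero.ne L))
  -- `a² = Re⟨Δ†Δ⟩ + Re⟨ΔΔ†⟩`
  have hNψ : (totalNumber : Matrix (Finset (Orb (FermionTorus 2 L))) _ ℂ) *ᵥ ψ = (((N : ℝ) : ℝ) : ℂ) • ψ := by
    rw [totalNumber_mulVec_of_isNParticle ((mem_szSector_iff _ _ ψ).1 hgs.1).1]
    push_cast
    rfl
  set av : ℝ := eucNorm ((pairField g L + (pairField g L)ᴴ) *ᵥ ψ) with hav
  have hav2eq : av ^ 2 = (expect ((pairField g L)ᴴ * pairField g L) ψ).re +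
      (expect (pairField g L * (pairField g L)ᴴ) ψ).re :=
    eucNorm_sq_add_conjTranspose_mulVec totalNumber_isHermitian (totalNumber_commutator_pairField g L)
      two_ne_zero hNψ
  have hBnonneg : 0 ≤ (expect (pairField g L * (pairField g L)ᴴ) ψ).re :=
    (Complex.nonneg_iff.1
      ((Matrix.posSemidef_self_mul_conjTranspose (pairField g L)).dotProduct_mulVec_nonneg ψ)).1
  have hγ' : |(expect (pairField g L * (pairField g L)ᴴ) ψ).re -
      (expect ((pairField g L)ᴴ * pairField g L) ψ).re| ≤ Cγ * (L : ℝ) ^ 2 := by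
    have e : expect (pairField g L * (pairField g L)ᴴ - (pairField g L)ᴴ * pairField g L) ψ =
        expect (pairField g L * (pairField g L)ᴴ) ψ - expect ((pairField g L)ᴴ * pairField g L) ψ := by
      simp [Literature.MathematicalPhysics.QuantumLattice.expect, sub_mulVec, dotProduct_sub]
    have h := hγ
    rwa [e, Complex.sub_re] at h
  have hav2 : 2 * c₀ * (L : ℝ) ^ 4 - Cγ * (L : ℝ) ^ 2 ≤ av ^ 2 := by
    have h := (abs_le.1 hγ').1
    rw [hav2eq]
    linarith
  have hav2' : c₀ * (L : ℝ) ^ 4 ≤ av ^ 2 := by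
    rw [hav2eq]
    linarith
  have hav_pos : 0 < av := by
    have h4 : 0 < c₀ * (L : ℝ) ^ 4 := by positivity
    have hnn : 0 ≤ av := eucNorm_nonneg _
    rcases hnn.lt_or_eq with hlt | heq
    · exact hlt
    · exfalso
      rw [← heq] at hav2'
      have : c₀ * (L : ℝ) ^ 4 ≤ 0 := by simpa using hav2'
      linarith
  obtain ⟨Ξ, hΞ1, hΞP, hΞH, hΞN⟩ :=
    exists_onePointWitness_numerics g hHh hψ1 hgs hav hav_pos hγ' hδ
  have hwin := hbound Ξ hΞ1
  rw [hΞP, ← neg_div] at hwin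
  exact onePoint_real_step μ (fun σ => (star Ξ ⬝ᵥ ((∑ y : FermionTorus 2 L, numberOp y σ) *ᵥ Ξ)).re)
    hL hav_pos hc₀ hκ hCγ hCδ hav2 hav2' hΞN hΞH hwin

end Finite

/-! ### §2  Families of sector ground states: `liminf u_k ≤ 2M²` -/

section Family

variable (g : Site 2 → ℝ)

/-- **A certified one-point variational bound is a ceiling on the summit's pair-field LRO sequence.**
Let `U ≥ 0`, `0 ≤ n < 2`, `κ ≥ 0`, `e(t, 0, U, n) ≤ u`, and suppose the one-point bound (OP1)
`c − A + Σ_σ μ_σ (Re⟨ζ, N_σ ζ⟩/L² − ν) + κ (u − Re⟨ζ, H_L ζ⟩/L²) ≤ −Re⟨ζ, Δ_g ζ⟩/L²` holds for every unit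
vector `ζ` of every torus of side `L ≥ L₁` (`H_L = hubbardTorus 2 L t U`). Then for EVERY family `ψ_L` of
unit `(rectN n L, S^z = 0)`-sector ground states the sequence
`u_k = |Λ_{2k}|⁻² Σ_{x,y ∈ Λ_{2k}} P_g(2k; x, y)` of `HubbardSuperconductivity` obeys
`liminf_k u_k ≤ 2 M²`, `M = −(c − A + (Σ_σ μ_σ)(n/2 − ν))` (written as `2 (c − A + (Σμ)(n/2 − ν))²`).
Koma–Tasaki 1994 Theorem 2.2 with the sourced order parameter replaced by a direct one-point bound over
low-energy number-indefinite states. [cite: KomaTasaki1994, Theorem 2.2] [cite: WangEtAl2024, §III]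
[cite: Scalapino1995, §2 eq. (2.4)] -/
theorem liminf_pairFieldLRO_le_of_onePoint_variational_bound (t : ℝ) {U n : ℝ} (hU : 0 ≤ U)
    (hn0 : 0 ≤ n) (hn2 : n < 2) {c A κ u ν : ℝ} (μ : Fin 2 → ℝ) (hκ : 0 ≤ κ)
    (hu : energyDensityTT' t 0 U n ≤ u) (L₁ : ℕ)
    (hbound : ∀ (L : ℕ) [NeZero L], L₁ ≤ L → ∀ ζ : Fock (Orb (FermionTorus 2 L)), star ζ ⬝ᵥ ζ = 1 →
      c - A + ∑ σ : Fin 2, μ σ *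
          ((star ζ ⬝ᵥ ((∑ y : FermionTorus 2 L, numberOp y σ) *ᵥ ζ)).re / (L : ℝ) ^ 2 - ν) +
        κ * (u - (star ζ ⬝ᵥ (hubbardTorus 2 L t U *ᵥ ζ)).re / (L : ℝ) ^ 2) ≤
        -((expect (pairField g L) ζ).re / (L : ℝ) ^ 2))
    (ψ : ∀ L, Fock (Orb (FermionTorus 2 L)))
    (hψ : ∀ L, IsGroundStateInSector (hubbardTorus 2 L t U) (rectN n L) 0 (ψ L))
    (hψ1 : ∀ L, star (ψ L) ⬝ᵥ ψ L = 1) :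
    liminf (fun k : ℕ => (∑ x ∈ halfOpenBox 2 (2 * k), ∑ y ∈ halfOpenBox 2 (2 * k),
        torusPullback (pairFieldCorr g ψ) (2 * k) x y) / ((#(halfOpenBox 2 (2 * k)) : ℝ)) ^ 2) atTop ≤
      2 * (c - A + (∑ σ : Fin 2, μ σ) * (n / 2 - ν)) ^ 2 := by
  obtain ⟨Cγ, Lγ, hCγ, hγ⟩ := exists_abs_re_expect_commutator_pairField_le g
  obtain ⟨Cδ, Lδ, hCδ, hδ⟩ := exists_norm_expect_doubleCommutator_pairField_le g t U
  set M : ℝ := -(c - A + (∑ σ : Fin 2, μ σ) * (n / 2 - ν)) with hM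
  have hM2 : 2 * (c - A + (∑ σ : Fin 2, μ σ) * (n / 2 - ν)) ^ 2 = 2 * M ^ 2 := by rw [hM, neg_sq]
  rw [hM2]
  set useq : ℕ → ℝ := fun k => (∑ x ∈ halfOpenBox 2 (2 * k), ∑ y ∈ halfOpenBox 2 (2 * k),
      torusPullback (pairFieldCorr g ψ) (2 * k) x y) / ((#(halfOpenBox 2 (2 * k)) : ℝ)) ^ 2 with huseq
  change liminf useq atTop ≤ 2 * M ^ 2
  -- the LRO quantity at side `m + 1`
  set vseq : ℕ → ℝ := fun m =>
    (expect ((pairField g (m + 1))ᴴ * pairField g (m + 1)) (ψ (m + 1))).re / (((m + 1 : ℕ) : ℝ)) ^ 4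
    with hvseq
  -- the `k`-th term (for `k ≥ 1`) is `Re⟨ψ_{2k}, Δ†Δ ψ_{2k}⟩ / (2k)⁴`
  have hterm : ∀ k : ℕ, 1 ≤ k → ∃ m : ℕ, 2 * k = m + 1 ∧ useq k = vseq m := by
    intro k hk
    obtain ⟨m, hm⟩ : ∃ m, 2 * k = m + 1 := ⟨2 * k - 1, by omega⟩
    refine ⟨m, hm, ?_⟩
    simp only [huseq, hvseq]
    rw [hm, torusLROSeq_pairFieldCorr_succ]
  have hvnonneg : ∀ m : ℕ, 0 ≤ vseq m := fun m => by
    simp only [hvseq]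
    refine div_nonneg ?_ (by positivity)
    exact (Complex.nonneg_iff.1
      ((Matrix.posSemidef_conjTranspose_mul_self (pairField g (m + 1))).dotProduct_mulVec_nonneg
        (ψ (m + 1)))).1
  have hnonneg : ∀ k : ℕ, 1 ≤ k → 0 ≤ useq k := fun k hk => by
    obtain ⟨m, -, heq⟩ := hterm k hk
    rw [heq]
    exact hvnonneg m
  have hbdd : IsBoundedUnder (· ≥ ·) atTop useq :=
    isBoundedUnder_of_eventually_ge (a := 0) (Filter.eventually_atTop.2 ⟨1, fun k hk => hnonneg k hk⟩)
  by_contra hcon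
  rw [not_le] at hcon
  obtain ⟨c₀, hc₀M, hc₀lim⟩ := exists_between hcon
  have hc₀ : 0 < c₀ := lt_of_le_of_lt (by positivity) hc₀M
  have hev : ∀ᶠ k : ℕ in atTop, c₀ < useq k := eventually_lt_of_lt_liminf hc₀lim hbdd
  -- the comparison sequences
  set K : ℝ := ((∑ σ : Fin 2, |μ σ|) * Cγ / 2 + κ * Cδ / 4) / c₀ with hK
  set Lr : ℕ → ℝ := fun k => ((2 * k : ℕ) : ℝ) with hLr
  set Eseq : ℕ → ℝ := fun k =>
    groundEnergy (hubbardTorusTT' (2 * k) t 0 U) (rectN n (2 * k)) / ((2 * k : ℕ) : ℝ) ^ 2 with hEseq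
  set Nseq : ℕ → ℝ := fun k => (rectN n (2 * k) : ℝ) / ((2 * k : ℕ) : ℝ) ^ 2 with hNseq
  set lhs : ℕ → ℝ := fun k => Real.sqrt (2 * c₀ - Cγ / Lr k ^ 2) / 2 with hlhs
  set rhs : ℕ → ℝ := fun k =>
    -(c - A + (∑ σ : Fin 2, μ σ) * (Nseq k / 2 - ν) + κ * (u - Eseq k)) + K / Lr k ^ 4 with hrhs
  -- the finite-volume step, eventually in `k`
  have hstep : ∀ᶠ k : ℕ in atTop, lhs k ≤ rhs k := by
    filter_upwards [hev, Filter.eventually_ge_atTop (max 1 (max L₁ (max Lγ Lδ)))] with k hk hkL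
    have hk1 : 1 ≤ k := le_trans (le_max_left _ _) hkL
    have hkL₁ : L₁ ≤ k := le_trans (le_trans (le_max_left _ _) (le_max_right _ _)) hkL
    have hkγ : Lγ ≤ k :=
      le_trans (le_trans (le_trans (le_max_left _ _) (le_max_right _ _)) (le_max_right _ _)) hkL
    have hkδ : Lδ ≤ k :=
      le_trans (le_trans (le_trans (le_max_right _ _) (le_max_right _ _)) (le_max_right _ _)) hkL
    obtain ⟨m, hm, heq⟩ := hterm k hk1
    have hmL₁ : L₁ ≤ m + 1 := by omega
    have hmγ : Lγ ≤ m + 1 := by omega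
    have hmδ : Lδ ≤ m + 1 := by omega
    have hlro : c₀ * (((m + 1 : ℕ) : ℝ)) ^ 4 ≤
        (expect ((pairField g (m + 1))ᴴ * pairField g (m + 1)) (ψ (m + 1))).re := by
      have h := hk.le
      rw [heq] at h
      simp only [hvseq] at h
      rwa [le_div_iff₀ (by positivity)] at h
    have h := onePoint_finite_step g t U (hψ1 (m + 1)) (hψ (m + 1)) μ hκ hc₀ hCγ hCδ
      (hγ (m + 1) hmγ _ (hψ1 _)) (hδ (m + 1) hmδ _ (hψ1 _)) hlro (hbound (m + 1) hmL₁)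
    -- identify `minEnergyOn` with the sector ground-state energy
    have hcard : ⌊n * (((m + 1 : ℕ)) : ℝ) ^ 2 / 2⌋₊ ≤ Fintype.card (FermionTorus 2 (m + 1)) := by
      rw [show Fintype.card (FermionTorus 2 (m + 1)) = (m + 1) ^ 2 by simp]
      have h2 := rectN_le_two_mul hn0 hn2.le (m + 1)
      simp only [rectN] at h2
      have e : (m + 1) ^ 2 = (m + 1) * (m + 1) := by ring
      rw [e]
      exact Nat.le_of_mul_le_mul_left h2 (by norm_num)
    have hE : (hubbardTorus 2 (m + 1) t U).minEnergyOn (szSector (rectN n (m + 1)) 0) =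
        groundEnergy (hubbardTorusTT' (m + 1) t 0 U) (rectN n (m + 1)) := by
      simp only [rectN]
      rw [groundEnergy_hubbardTorusTT'_eq_minEnergyOn_szSector (m + 1) t 0 U hcard, hubbardTorusTT'_zero]
    rw [hE, ← hK] at h
    have e1 : ((rectN n (m + 1) : ℕ) : ℝ) / 2 / (((m + 1 : ℕ) : ℝ)) ^ 2 =
        ((rectN n (m + 1) : ℕ) : ℝ) / (((m + 1 : ℕ) : ℝ)) ^ 2 / 2 := div_right_comm _ _ _
    rw [e1] at h
    simp only [hlhs, hrhs, hLr, hNseq, hEseq]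
    rw [hm]
    exact h
  -- limits of the two sides
  have h2k : Tendsto (fun k : ℕ => 2 * k) atTop atTop := Filter.tendsto_id.const_mul_atTop' (by norm_num)
  have hLr_top : Tendsto Lr atTop atTop := tendsto_natCast_atTop_atTop.comp h2k
  have hLr2 : Tendsto (fun k => (Lr k ^ 2)⁻¹) atTop (𝓝 0) :=
    ((tendsto_pow_atTop (α := ℝ) two_ne_zero).comp hLr_top).inv_tendsto_atTop
  have hLr4 : Tendsto (fun k => (Lr k ^ 4)⁻¹) atTop (𝓝 0) :=
    ((tendsto_pow_atTop (α := ℝ) (by norm_num : (4 : ℕ) ≠ 0)).comp hLr_top).inv_tendsto_atTop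
  have hlhs_lim : Tendsto lhs atTop (𝓝 (Real.sqrt (2 * c₀) / 2)) := by
    have h1 : Tendsto (fun k => 2 * c₀ - Cγ * (Lr k ^ 2)⁻¹) atTop (𝓝 (2 * c₀ - Cγ * 0)) :=
      tendsto_const_nhds.sub (hLr2.const_mul Cγ)
    rw [mul_zero, sub_zero] at h1
    have h2 := (h1.sqrt).div_const 2
    refine h2.congr' (Eventually.of_forall fun k => ?_)
    simp [hlhs, div_eq_mul_inv]
  have hE_lim : Tendsto Eseq atTop (𝓝 (energyDensityTT' t 0 U n)) :=
    (tendsto_energyDensityTT'_torus t 0 hU hn0 hn2).comp h2k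
  have hN_lim : Tendsto Nseq atTop (𝓝 n) := (tendsto_rectN_div_sq hn0).comp h2k
  have hrhs_lim : Tendsto rhs atTop
      (𝓝 (-(c - A + (∑ σ : Fin 2, μ σ) * (n / 2 - ν) + κ * (u - energyDensityTT' t 0 U n)) + K * 0)) := by
    have h1 : Tendsto (fun k => -(c - A + (∑ σ : Fin 2, μ σ) * (Nseq k / 2 - ν) + κ * (u - Eseq k)))
        atTop (𝓝 (-(c - A + (∑ σ : Fin 2, μ σ) * (n / 2 - ν) + κ * (u - energyDensityTT' t 0 U n)))) :=
      ((tendsto_const_nhds.add (((hN_lim.div_const 2).sub tendsto_const_nhds).const_mul _)).add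
        ((tendsto_const_nhds.sub hE_lim).const_mul κ)).neg
    have h2 := h1.add (hLr4.const_mul K)
    refine h2.congr' (Eventually.of_forall fun k => ?_)
    simp [hrhs, div_eq_mul_inv]
  have hle := le_of_tendsto_of_tendsto hlhs_lim hrhs_lim hstep
  rw [mul_zero, add_zero] at hle
  have hslack : 0 ≤ κ * (u - energyDensityTT' t 0 U n) := mul_nonneg hκ (sub_nonneg.2 hu)
  have hsqM : Real.sqrt (2 * c₀) ≤ 2 * M := by linarith [hM, hle, hslack]
  have hsq : 2 * c₀ ≤ (2 * M) ^ 2 := by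
    have h := pow_le_pow_left₀ (Real.sqrt_nonneg _) hsqM 2
    rwa [Real.sq_sqrt (by linarith)] at h
  nlinarith

/-- **Registry consumer at the M3 point `(U, n, t') = (8, 7/8, 0)`, `g = g_d`.** A one-point variational
bound (OP1) for `H_L = hubbardTorus 2 L 1 8` with constants `(c, A, μ, ν, κ ≥ 0, u)`, together with the cap
node `M3EnergyUpperRow 0 hi` and `hi ≤ u`, gives the summit-format leaf `M3ObsPairLROCeilingAt_tp0 c'` for
every rational `c' ≥ 2M²`, `M = −(c − A + (Σ_σ μ_σ)(7/16 − ν))` — conditional on nothing but the fed-in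
bound and cap node. [cite: KomaTasaki1994, Theorem 2.2] [cite: WangEtAl2024, §III] -/
theorem M3ObsPairLROCeilingAt_tp0_of_onePoint_variational_bound {hi c' : ℚ} {c A κ u ν : ℝ}
    (μ : Fin 2 → ℝ) (hκ : 0 ≤ κ) (hE : M3EnergyUpperRow 0 hi) (hhi : ((hi : ℚ) : ℝ) ≤ u) (L₁ : ℕ)
    (hbound : ∀ (L : ℕ) [NeZero L], L₁ ≤ L → ∀ ζ : Fock (Orb (FermionTorus 2 L)), star ζ ⬝ᵥ ζ = 1 →
      c - A + ∑ σ : Fin 2, μ σ *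
          ((star ζ ⬝ᵥ ((∑ y : FermionTorus 2 L, numberOp y σ) *ᵥ ζ)).re / (L : ℝ) ^ 2 - ν) +
        κ * (u - (star ζ ⬝ᵥ (hubbardTorus 2 L 1 8 *ᵥ ζ)).re / (L : ℝ) ^ 2) ≤
        -((expect (pairField dWaveFormFactor L) ζ).re / (L : ℝ) ^ 2))
    (hc' : 2 * (c - A + (∑ σ : Fin 2, μ σ) * ((7 / 8 : ℝ) / 2 - ν)) ^ 2 ≤ ((c' : ℚ) : ℝ)) :
    M3ObsPairLROCeilingAt_tp0 c' := by
  intro ψ hψ hψ1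
  have hu : energyDensityTT' 1 0 8 (7 / 8) ≤ u :=
    (show energyDensityTT' 1 0 8 (7 / 8) ≤ ((hi : ℚ) : ℝ) from hE).trans hhi
  have hψ' : ∀ L, IsGroundStateInSector (hubbardTorus 2 L 1 8) (rectN (7 / 8) L) 0 (ψ L) := fun L => by
    rw [← hubbardTorusTT'_zero]; exact hψ L
  exact (liminf_pairFieldLRO_le_of_onePoint_variational_bound dWaveFormFactor 1 (by norm_num) (by norm_num)
    (by norm_num) μ hκ hu L₁ hbound ψ hψ' hψ1).trans hc'

/-- **Thence the route item `StripePointCeiling` (stmt-HubbardSuperconductivity-9492) whenever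
`2M² ≤ 1/200`** (`stripePointCeiling_of_pairLROCeilingAt`, Observables/StripePointBridge). HONEST: no such
bound is certified at filing time. [cite: Scalapino1995, §2 eq. (2.4)] -/
theorem stripePointCeiling_of_onePoint_variational_bound {hi : ℚ} {c A κ u ν : ℝ}
    (μ : Fin 2 → ℝ) (hκ : 0 ≤ κ) (hE : M3EnergyUpperRow 0 hi) (hhi : ((hi : ℚ) : ℝ) ≤ u) (L₁ : ℕ)
    (hbound : ∀ (L : ℕ) [NeZero L], L₁ ≤ L → ∀ ζ : Fock (Orb (FermionTorus 2 L)), star ζ ⬝ᵥ ζ = 1 →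
      c - A + ∑ σ : Fin 2, μ σ *
          ((star ζ ⬝ᵥ ((∑ y : FermionTorus 2 L, numberOp y σ) *ᵥ ζ)).re / (L : ℝ) ^ 2 - ν) +
        κ * (u - (star ζ ⬝ᵥ (hubbardTorus 2 L 1 8 *ᵥ ζ)).re / (L : ℝ) ^ 2) ≤
        -((expect (pairField dWaveFormFactor L) ζ).re / (L : ℝ) ^ 2))
    (hsmall : 2 * (c - A + (∑ σ : Fin 2, μ σ) * ((7 / 8 : ℝ) / 2 - ν)) ^ 2 ≤ 1 / 200) :
    Summit.HubbardSuperconductivity.HubbardSuperconductivity.Theses.AbsenceCertificate.StripePointCeiling :=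
  stripePointCeiling_of_pairLROCeilingAt (c' := 1 / 200)
    (M3ObsPairLROCeilingAt_tp0_of_onePoint_variational_bound μ hκ hE hhi L₁ hbound (by push_cast; linarith))
    (by push_cast; norm_num)

end Family

end Summit.Ventures.CertifiedManyBodySolver.Observables

end
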